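import Summits.AtomisticToContinuum.BoseEinsteinCondensation.Theses.BECDeletionChiSquare
import Literature.MathematicalPhysics.QuantumManyBody.GroundState
import Literature.MathematicalPhysics.QuantumManyBody.MeanSelfDensity

/-!
# Birth skeleton (BC3) — crux `DeletionReachesGroundState` (stmt-AtomisticToContinuum-11945) of
# route-AtomisticToContinuum-BECDeletionChiSquare

Crux (the route decl, concluded BY NAME below):
`Summit.AtomisticToContinuum.BoseEinsteinCondensation.Theses.BECDeletionChiSquare.DeletionReachesGroundState`
— for every repulsive finite-range `v` there is `ρ₀ > 0` such that for `0 < ρ < ρ₀`, eventually in `n`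
(`N = n+1`, `L = sideLength ρ N`), for every `C > 0`: IF for every slack `δ > 0` SOME `δ`-near-minimiser
`Ψ` of the Dirichlet energy has mean self-conditional density `m₂(Ψ) ≤ C` (the inlined term is
`BoseGas.meanSelfDensity n L Ψ.ψ` by `rfl`), THEN there is `δ > 0` such that EVERY `δ`-near-minimiser
has constant-mode occupation `⟨φ₀, γ_Ψ φ₀⟩ ≥ N/(2C)`, `φ₀ = L^{-3/2} 1_{Λ_L}`.

Line = the route's own two-layer plan for this frame crux
(`GroundStateConvergence → SemicontinuityTransfer → DeletionReachesGroundState`), cut into SIX named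
lemmas over the tree's ground-state vocabulary (`Literature/…/QuantumManyBody/GroundState.lean`:
`IsGroundState`, `groundState`, `HasUniqueGroundState`, `TendstoL2`; `MeanSelfDensity.lean`:
`meanSelfDensity`), so that existence, uniqueness, compactness and the two semicontinuities are
separately provable and two of them are shared verbatim with the birth skeleton of
`Cruxes/GroundStateCondensate` (route BECInsertionVariance):

* `stub_groundState_exists` (E; L) — EXISTENCE of a nonnegative Dirichlet ground state, eventually in `N`
  at low density: `E₀(N, L) < ⊤` for `ρ R₀³` small (finite range: `N` bumps placed pairwise farther
  than `R₀`), minimising sequences are `H¹₀(Λ_L^N)`-bounded, Rellich–Kondrachov on the bounded box,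
  `IsGroundState.of_tendstoL2`, and `|Ψ|`-smoothing for a nonnegative minimiser (Reed–Simon IV
  Thm XIII.64, §XIII.14–15).
* `stub_groundStateUnique` (U; L–XL, HARDEST — the crux's recorded risk) — UNIQUENESS UP TO PHASE,
  eventually in `N` at low density, no existence claimed; VERBATIM the stub `stub_groundStateUnique` of
  `Cruxes/GroundStateCondensate/Lines/birth.lean` (one proof closes both). Finite `v`: Perron–Frobenius
  for the positivity-improving Dirichlet semigroup (Reed–Simon IV Thms XIII.44–47; Feynman–Kac side in
  tree for bounded `v`); hard cores / `⊤`-shells: connectivity / energetic dominance of the fluid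
  component of the accessible region at low density (XIII.48(b) is the warning; Kahle2012,
  BaryshnikovBubenikKahle2013).
* `stub_nearMinimisers_tendstoL2` (K; L) — COMPACTNESS OF NEAR-MINIMISERS modulo phase at fixed `N, L`
  under `HasUniqueGroundState`; VERBATIM the stub of the same name of `Cruxes/GroundStateCondensate`.
* `stub_meanSelfDensity_lsc` (M; M–L) — `m₂` IS `L²`-LOWER-SEMICONTINUOUS along trial states converging
  to a phase multiple of a measurable `Φ` (liminf-realising subsequence, a.e.-convergent sub-subsequence
  with a.e.-convergent bath marginals, then the tree's Fatou lemma `meanSelfDensity_le_liminf` and the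
  phase invariance `meanSelfDensity_const_mul_of_norm_eq_one`).
* `stub_occupation_lsc` (O; M) — the occupation `⟨φ, γ_Ψ φ⟩` of a fixed square-integrable mode `φ` is
  `L²`-lower-semicontinuous along trial states (it is `N ×` the squared `L²(dY)`-norm of the contraction
  `Ψ ↦ ∫ conj φ · Ψ(·, Y)`; Cauchy–Schwarz in `x`, Tonelli through the `vecCons` split; the Bochner
  integral of the limit is a genuine integral for a.e. `Y`).
* `stub_deletionBound` (D; M) — VERBATIM the route's support item `DeletionBound`
  (stmt-AtomisticToContinuum-11946): `N ≤ n₀(Ψ) · m₂(Ψ)` for measurable, Dirichlet, pointwise real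
  nonnegative, normalised `Ψ` (Hölder `b³ ≤ S²A` in `x`, Cauchy–Schwarz in `Y`).

Assembly (REAL proofs, no `sorry`): `le_of_nearMinimisers` (the `δ_k = k⁻¹` extraction: compactness +
a semicontinuity turn "for every `δ` some `δ`-near-minimiser has `F ≤ m`" into `F(Ψ₀) ≤ m`),
`transfer_fixedN` (at fixed `N = n+1`, `L > 0` under `HasUniqueGroundState`: `m₂(Ψ₀) ≤ C` by K+M;
`N ≤ n₀(Ψ₀) m₂(Ψ₀)` by D for `Ψ₀ = groundState ≥ 0`; if the conclusion failed, K+O would give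
`n₀(Ψ₀) ≤ N/(2C)`, whence `N ≤ (N/(2C))·C = N/2`, absurd), and `DeletionReachesGroundState_of`
(intersect the eventualities of E and U, `HasUniqueGroundState := ⟨E, U⟩`, `L = sideLength ρ (n+1) > 0`).

Disproof used: none exists for this crux (`ledger crux ls stmt-AtomisticToContinuum-11945`: no
workfiles, 2026-08-17). The refuter crux-attack (EVIDENCE.md, 2026-08-15, SURVIVES) names two failure
modes: `E₀ = ⊤` (answered by stub E: existence forces `E₀ < ⊤`, `IsGroundState.groundStateEnergy_ne_top`)
and a degenerate ground space for `⊤`-valued `v` (isolated as stub U).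
-/

namespace Summit.AtomisticToContinuum.BoseEinsteinCondensation.Cruxes.DeletionReachesGroundState.Birth

open MeasureTheory Filter
open scoped ENNReal Topology ComplexConjugate

/-! ### Registered stubs (the ONLY `sorry`s of this file) -/

/-- Stub E (L): EXISTENCE of a nonnegative Dirichlet ground state, eventually in `N` at small density. For
repulsive finite-range `v` there is `ρ₀ > 0` such that for `0 < ρ < ρ₀` and all large `N = n+1` the
`N`-boson problem in the Dirichlet box of side `(N/ρ)^{1/3}` has a ground state `Ψ₀ ≥ 0`
(`IsGroundState` = normalised minimiser of the closed form; in particular `E₀(N, L) < ⊤`). -/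
theorem stub_groundState_exists :
    ∀ v : ℝ → ENNReal, Literature.MathematicalPhysics.QuantumManyBody.BoseGas.IsRepulsiveFiniteRange v →
      ∃ ρ₀ : ℝ, 0 < ρ₀ ∧ ∀ ρ : ℝ, 0 < ρ → ρ < ρ₀ → ∀ᶠ n : ℕ in Filter.atTop,
        ∃ Ψ₀ : Literature.MathematicalPhysics.QuantumManyBody.BoseGas.Config (n + 1) → ℝ,
          (∀ X, 0 ≤ Ψ₀ X) ∧
            Literature.MathematicalPhysics.QuantumManyBody.BoseGas.IsGroundState v
              (Literature.MathematicalPhysics.QuantumManyBody.BoseGas.sideLength ρ (n + 1))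
              (fun X => (Ψ₀ X : ℂ)) := by
  sorry

/-- Stub U (L–XL, HARDEST — the crux's recorded risk): UNIQUENESS of the ground state up to phase,
eventually in `N` at small density; NO existence claimed. For repulsive finite-range `v`, all sufficiently
small densities `ρ` and all large `N = n+1`, any two ground states of `H_N` in the Dirichlet box of side
`(N/ρ)^{1/3}` agree a.e. up to a constant phase. (Verbatim the stub of the same name of
`Cruxes/GroundStateCondensate/Lines/birth.lean`.) -/
theorem stub_groundStateUnique :
    ∀ v : ℝ → ENNReal, Literature.MathematicalPhysics.QuantumManyBody.BoseGas.IsRepulsiveFiniteRange v →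
      ∃ ρ₀ : ℝ, 0 < ρ₀ ∧ ∀ ρ : ℝ, 0 < ρ → ρ < ρ₀ → ∀ᶠ n : ℕ in Filter.atTop,
        ∀ Ψ Φ : Literature.MathematicalPhysics.QuantumManyBody.BoseGas.Config (n + 1) → ℂ,
          Literature.MathematicalPhysics.QuantumManyBody.BoseGas.IsGroundState v
              (Literature.MathematicalPhysics.QuantumManyBody.BoseGas.sideLength ρ (n + 1)) Ψ →
          Literature.MathematicalPhysics.QuantumManyBody.BoseGas.IsGroundState v
              (Literature.MathematicalPhysics.QuantumManyBody.BoseGas.sideLength ρ (n + 1)) Φ →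
            ∃ c : ℂ, ‖c‖ = 1 ∧
              ∀ᵐ X : Literature.MathematicalPhysics.QuantumManyBody.BoseGas.Config (n + 1),
                Φ X = c * Ψ X := by
  sorry

/-- Stub K (L): COMPACTNESS of near-minimisers modulo phase at fixed `N, L` — under nondegeneracy, every
sequence of admissible trial states whose energies are within `δ_k → 0` of `E₀(N, L)` has a subsequence
converging in `L²` to a constant phase times THE nonnegative ground state (Rellich–Kondrachov on `Λ_L^N`,
closedness `IsGroundState.of_tendstoL2`, uniqueness). (Verbatim the stub of the same name of
`Cruxes/GroundStateCondensate/Lines/birth.lean`.) -/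
theorem stub_nearMinimisers_tendstoL2 :
    ∀ (v : ℝ → ENNReal) (N : ℕ) (L : ℝ),
      Literature.MathematicalPhysics.QuantumManyBody.BoseGas.IsRepulsiveFiniteRange v →
      Literature.MathematicalPhysics.QuantumManyBody.BoseGas.HasUniqueGroundState v N L →
        ∀ (Ψ : ℕ → Literature.MathematicalPhysics.QuantumManyBody.BoseGas.TrialState N L)
          (δ : ℕ → ENNReal),
          (∀ k, Literature.MathematicalPhysics.QuantumManyBody.BoseGas.energy v (Ψ k) ≤
              Literature.MathematicalPhysics.QuantumManyBody.BoseGas.groundStateEnergy v N L + δ k) →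
          Filter.Tendsto δ Filter.atTop (nhds 0) →
            ∃ φ : ℕ → ℕ, StrictMono φ ∧ ∃ c : ℂ, ‖c‖ = 1 ∧
              Literature.MathematicalPhysics.QuantumManyBody.BoseGas.TendstoL2 (fun k => Ψ (φ k))
                (fun X => c *
                  (Literature.MathematicalPhysics.QuantumManyBody.BoseGas.groundState v N L X : ℂ)) := by
  sorry

/-- Stub M (M–L): LOWER SEMICONTINUITY OF `m₂` along trial states, modulo phase, at fixed `N = n+1`, `L`:
if trial states `Θ_k` converge in `L²` to `c • Φ` with `|c| = 1` and `Φ` measurable, then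
`m₂(Φ) ≤ liminf_k m₂(Θ_k)` (`m₂ = BoseGas.meanSelfDensity n L`, blind to the phase). -/
theorem stub_meanSelfDensity_lsc :
    ∀ (n : ℕ) (L : ℝ)
      (Θ : ℕ → Literature.MathematicalPhysics.QuantumManyBody.BoseGas.TrialState (n + 1) L)
      (Φ : Literature.MathematicalPhysics.QuantumManyBody.BoseGas.Config (n + 1) → ℂ) (c : ℂ),
      Measurable Φ → ‖c‖ = 1 →
      Literature.MathematicalPhysics.QuantumManyBody.BoseGas.TendstoL2 Θ (fun X => c * Φ X) →
        Literature.MathematicalPhysics.QuantumManyBody.BoseGas.meanSelfDensity n L Φ ≤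
          Filter.liminf (fun k =>
            Literature.MathematicalPhysics.QuantumManyBody.BoseGas.meanSelfDensity n L (Θ k).ψ)
            Filter.atTop := by
  sorry

/-- Stub O (M): LOWER SEMICONTINUITY OF THE OCCUPATION of a fixed square-integrable one-particle mode `φ`
along trial states, modulo phase, at fixed `N = n+1`, `L`: if trial states `Θ_k` converge in `L²` to
`c • Φ` with `|c| = 1` and `Φ` measurable, then `⟨φ, γ_Φ φ⟩ ≤ liminf_k ⟨φ, γ_{Θ_k} φ⟩`
(`BoseGas.occupation`; in fact continuity: the occupation is `N ×` the squared `L²(dY)` norm of an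
`L²`-contraction). -/
theorem stub_occupation_lsc :
    ∀ (n : ℕ) (L : ℝ) (φ : Literature.MathematicalPhysics.QuantumManyBody.BoseGas.Space → ℂ)
      (Θ : ℕ → Literature.MathematicalPhysics.QuantumManyBody.BoseGas.TrialState (n + 1) L)
      (Φ : Literature.MathematicalPhysics.QuantumManyBody.BoseGas.Config (n + 1) → ℂ) (c : ℂ),
      Measurable φ →
      ∫⁻ x : Literature.MathematicalPhysics.QuantumManyBody.BoseGas.Space, (‖φ x‖₊ : ENNReal) ^ 2 ≠ ⊤ →
      Measurable Φ → ‖c‖ = 1 →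
      Literature.MathematicalPhysics.QuantumManyBody.BoseGas.TendstoL2 Θ (fun X => c * Φ X) →
        Literature.MathematicalPhysics.QuantumManyBody.BoseGas.occupation (n + 1) φ Φ ≤
          Filter.liminf (fun k =>
            Literature.MathematicalPhysics.QuantumManyBody.BoseGas.occupation (n + 1) φ (Θ k).ψ)
            Filter.atTop := by
  sorry

/-- Stub D (M): the DELETION BOUND `N ≤ n₀(Ψ) · m₂(Ψ)` for every measurable `Ψ : Config (n+1) → ℂ` that
is pointwise real and `≥ 0`, vanishes off the box `Λ_L^{n+1}` and has `∫ |Ψ|² = 1`, with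
`n₀ =` occupation of `φ₀ = L^{-3/2} 1_{Λ_L}` and `m₂ = L³ ∫_Y ∫_x |Ψ(x::Y)|⁴ / ∫_x' |Ψ(x'::Y)|²`
(Hölder in `x`, Cauchy–Schwarz in `Y`). VERBATIM the route's support item `BECDeletionChiSquare.DeletionBound`
(stmt-AtomisticToContinuum-11946; `Iff.rfl`, see `Goal.stub_deletionBound_iff`). -/
theorem stub_deletionBound :
    ∀ (n : ℕ) (L : ℝ), 0 < L → ∀ Ψ : Literature.MathematicalPhysics.QuantumManyBody.BoseGas.Config (n + 1) → ℂ, Measurable Ψ → (∀ X, X ∉ Literature.MathematicalPhysics.QuantumManyBody.BoseGas.boxN (n + 1) L → Ψ X = 0) → (∀ X, (Ψ X).im = 0 ∧ 0 ≤ (Ψ X).re) → ∫⁻ X, (‖Ψ X‖₊ : ENNReal) ^ 2 = 1 → ((n + 1 : ℕ) : ENNReal) ≤ Literature.MathematicalPhysics.QuantumManyBody.BoseGas.occupation (n + 1) ((Literature.MathematicalPhysics.QuantumManyBody.BoseGas.box L).indicator fun _ => ((Real.sqrt (L ^ 3))⁻¹ : ℂ)) Ψ * (ENNReal.ofReal (L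 ^ 3) * (∫⁻ Y : Literature.MathematicalPhysics.QuantumManyBody.BoseGas.Config n, ∫⁻ x : Literature.MathematicalPhysics.QuantumManyBody.BoseGas.Space, (‖Ψ (Matrix.vecCons x Y)‖₊ : ENNReal) ^ 4 / (∫⁻ x' : Literature.MathematicalPhysics.QuantumManyBody.BoseGas.Space, (‖Ψ (Matrix.vecCons x' Y)‖₊ : ENNReal) ^ 2))) := by
  sorry

/-! ### Audit names of the stub statements

`Goal.stub_x : Prop` is VERBATIM the statement of the registered stub `stub_x` above, so that the skeleton audit
(`#h21_check_skeleton`, by-name policy on hypothesis heads) reads the hypotheses of `DeletionReachesGroundState_of`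
as exactly the six declared stubs; `DeletionReachesGroundState_proof` below is the kernel-checked guard that the
two copies agree (the `@[stub]` tag is gate-reserved, hence plain `abbrev`s, as in the accepted
`Cruxes/GroundStateCondensate/Lines/birth.lean`). -/

namespace Goal

/-- Statement of stub E `stub_groundState_exists`. -/
abbrev stub_groundState_exists : Prop :=
    ∀ v : ℝ → ENNReal, Literature.MathematicalPhysics.QuantumManyBody.BoseGas.IsRepulsiveFiniteRange v →
      ∃ ρ₀ : ℝ, 0 < ρ₀ ∧ ∀ ρ : ℝ, 0 < ρ → ρ < ρ₀ → ∀ᶠ n : ℕ in Filter.atTop,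
        ∃ Ψ₀ : Literature.MathematicalPhysics.QuantumManyBody.BoseGas.Config (n + 1) → ℝ,
          (∀ X, 0 ≤ Ψ₀ X) ∧
            Literature.MathematicalPhysics.QuantumManyBody.BoseGas.IsGroundState v
              (Literature.MathematicalPhysics.QuantumManyBody.BoseGas.sideLength ρ (n + 1))
              (fun X => (Ψ₀ X : ℂ))

/-- Statement of stub U `stub_groundStateUnique`. -/
abbrev stub_groundStateUnique : Prop :=
    ∀ v : ℝ → ENNReal, Literature.MathematicalPhysics.QuantumManyBody.BoseGas.IsRepulsiveFiniteRange v →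
      ∃ ρ₀ : ℝ, 0 < ρ₀ ∧ ∀ ρ : ℝ, 0 < ρ → ρ < ρ₀ → ∀ᶠ n : ℕ in Filter.atTop,
        ∀ Ψ Φ : Literature.MathematicalPhysics.QuantumManyBody.BoseGas.Config (n + 1) → ℂ,
          Literature.MathematicalPhysics.QuantumManyBody.BoseGas.IsGroundState v
              (Literature.MathematicalPhysics.QuantumManyBody.BoseGas.sideLength ρ (n + 1)) Ψ →
          Literature.MathematicalPhysics.QuantumManyBody.BoseGas.IsGroundState v
              (Literature.MathematicalPhysics.QuantumManyBody.BoseGas.sideLength ρ (n + 1)) Φ →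
            ∃ c : ℂ, ‖c‖ = 1 ∧
              ∀ᵐ X : Literature.MathematicalPhysics.QuantumManyBody.BoseGas.Config (n + 1),
                Φ X = c * Ψ X

/-- Statement of stub K `stub_nearMinimisers_tendstoL2`. -/
abbrev stub_nearMinimisers_tendstoL2 : Prop :=
    ∀ (v : ℝ → ENNReal) (N : ℕ) (L : ℝ),
      Literature.MathematicalPhysics.QuantumManyBody.BoseGas.IsRepulsiveFiniteRange v →
      Literature.MathematicalPhysics.QuantumManyBody.BoseGas.HasUniqueGroundState v N L →
        ∀ (Ψ : ℕ → Literature.MathematicalPhysics.QuantumManyBody.BoseGas.TrialState N L)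
          (δ : ℕ → ENNReal),
          (∀ k, Literature.MathematicalPhysics.QuantumManyBody.BoseGas.energy v (Ψ k) ≤
              Literature.MathematicalPhysics.QuantumManyBody.BoseGas.groundStateEnergy v N L + δ k) →
          Filter.Tendsto δ Filter.atTop (nhds 0) →
            ∃ φ : ℕ → ℕ, StrictMono φ ∧ ∃ c : ℂ, ‖c‖ = 1 ∧
              Literature.MathematicalPhysics.QuantumManyBody.BoseGas.TendstoL2 (fun k => Ψ (φ k))
                (fun X => c *
                  (Literature.MathematicalPhysics.QuantumManyBody.BoseGas.groundState v N L X : ℂ))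

/-- Statement of stub M `stub_meanSelfDensity_lsc`. -/
abbrev stub_meanSelfDensity_lsc : Prop :=
    ∀ (n : ℕ) (L : ℝ)
      (Θ : ℕ → Literature.MathematicalPhysics.QuantumManyBody.BoseGas.TrialState (n + 1) L)
      (Φ : Literature.MathematicalPhysics.QuantumManyBody.BoseGas.Config (n + 1) → ℂ) (c : ℂ),
      Measurable Φ → ‖c‖ = 1 →
      Literature.MathematicalPhysics.QuantumManyBody.BoseGas.TendstoL2 Θ (fun X => c * Φ X) →
        Literature.MathematicalPhysics.QuantumManyBody.BoseGas.meanSelfDensity n L Φ ≤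
          Filter.liminf (fun k =>
            Literature.MathematicalPhysics.QuantumManyBody.BoseGas.meanSelfDensity n L (Θ k).ψ)
            Filter.atTop

/-- Statement of stub O `stub_occupation_lsc`. -/
abbrev stub_occupation_lsc : Prop :=
    ∀ (n : ℕ) (L : ℝ) (φ : Literature.MathematicalPhysics.QuantumManyBody.BoseGas.Space → ℂ)
      (Θ : ℕ → Literature.MathematicalPhysics.QuantumManyBody.BoseGas.TrialState (n + 1) L)
      (Φ : Literature.MathematicalPhysics.QuantumManyBody.BoseGas.Config (n + 1) → ℂ) (c : ℂ),
      Measurable φ →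
      ∫⁻ x : Literature.MathematicalPhysics.QuantumManyBody.BoseGas.Space, (‖φ x‖₊ : ENNReal) ^ 2 ≠ ⊤ →
      Measurable Φ → ‖c‖ = 1 →
      Literature.MathematicalPhysics.QuantumManyBody.BoseGas.TendstoL2 Θ (fun X => c * Φ X) →
        Literature.MathematicalPhysics.QuantumManyBody.BoseGas.occupation (n + 1) φ Φ ≤
          Filter.liminf (fun k =>
            Literature.MathematicalPhysics.QuantumManyBody.BoseGas.occupation (n + 1) φ (Θ k).ψ)
            Filter.atTop

/-- Statement of stub D `stub_deletionBound`. -/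
abbrev stub_deletionBound : Prop :=
    ∀ (n : ℕ) (L : ℝ), 0 < L → ∀ Ψ : Literature.MathematicalPhysics.QuantumManyBody.BoseGas.Config (n + 1) → ℂ, Measurable Ψ → (∀ X, X ∉ Literature.MathematicalPhysics.QuantumManyBody.BoseGas.boxN (n + 1) L → Ψ X = 0) → (∀ X, (Ψ X).im = 0 ∧ 0 ≤ (Ψ X).re) → ∫⁻ X, (‖Ψ X‖₊ : ENNReal) ^ 2 = 1 → ((n + 1 : ℕ) : ENNReal) ≤ Literature.MathematicalPhysics.QuantumManyBody.BoseGas.occupation (n + 1) ((Literature.MathematicalPhysics.QuantumManyBody.BoseGas.box L).indicator fun _ => ((Real.sqrt (L ^ 3))⁻¹ : ℂ)) Ψ * (ENNReal.ofReal (L ^ 3) * (∫⁻ Y : Literature.MathematicalPhysics.QuantumManyBody.BoseGas.Config n, ∫⁻ x : Literature.MathematicalPhysics.QuantumManyBody.BoseGas.Space, (‖Ψ (Matrix.vecCons x Y)‖₊ : ENNReal) ^ 4 / (∫⁻ x' : Literature.MathematicalPhysics.QuantumManyBody.BoseGas.Space, (‖Ψ (Matrix.vecCons x' Y)‖₊ :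 ENNReal) ^ 2)))

/-- Stub D is, definitionally, the route's support item `DeletionBound` (stmt-AtomisticToContinuum-11946):
a proof of either closes the other (`DeletionBound_holds ▸`). -/
theorem stub_deletionBound_iff :
    stub_deletionBound ↔
      Summit.AtomisticToContinuum.BoseEinsteinCondensation.Theses.BECDeletionChiSquare.DeletionBound :=
  Iff.rfl

end Goal

/-! ### Proved glue (no `sorry` below this line) -/

section Glue

open Literature.MathematicalPhysics.QuantumManyBody.BoseGas

/-- **The `δ_k = k⁻¹` extraction.** At fixed `N, L`: if near-minimisers are compact modulo phase towards
`Ψ₀` (`hK`) and the functional `F` is lower semicontinuous along trial states converging to a phase multiple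
of `Ψ₀` (`hF`), then "for every `δ > 0` some `δ`-near-minimiser has `F ≤ m`" forces `F Ψ₀ ≤ m`. -/
theorem le_of_nearMinimisers {v : ℝ → ℝ≥0∞} {N : ℕ} {L : ℝ} (Ψ₀ : Config N → ℂ)
    (F : (Config N → ℂ) → ℝ≥0∞) (m : ℝ≥0∞)
    (hK : ∀ (Ψ : ℕ → TrialState N L) (δ : ℕ → ℝ≥0∞),
      (∀ k, energy v (Ψ k) ≤ groundStateEnergy v N L + δ k) → Tendsto δ atTop (𝓝 0) →
        ∃ φ : ℕ → ℕ, StrictMono φ ∧ ∃ c : ℂ, ‖c‖ = 1 ∧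
          TendstoL2 (fun k => Ψ (φ k)) (fun X => c * Ψ₀ X))
    (hF : ∀ (Θ : ℕ → TrialState N L) (c : ℂ), ‖c‖ = 1 →
      TendstoL2 Θ (fun X => c * Ψ₀ X) → F Ψ₀ ≤ liminf (fun k => F (Θ k).ψ) atTop)
    (h : ∀ δ : ℝ≥0∞, 0 < δ → ∃ Ψ : TrialState N L,
      energy v Ψ ≤ groundStateEnergy v N L + δ ∧ F Ψ.ψ ≤ m) :
    F Ψ₀ ≤ m := by
  have key : ∀ k : ℕ, ∃ Ψ : TrialState N L,
      energy v Ψ ≤ groundStateEnergy v N L + (k : ℝ≥0∞)⁻¹ ∧ F Ψ.ψ ≤ m := fun k =>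
    h _ (ENNReal.inv_pos.2 (ENNReal.natCast_ne_top k))
  choose Ψ hΨE hΨm using key
  obtain ⟨φ, -, c, hc, hT⟩ :=
    hK Ψ (fun k => (k : ℝ≥0∞)⁻¹) hΨE ENNReal.tendsto_inv_nat_nhds_zero
  calc F Ψ₀ ≤ liminf (fun k => F (Ψ (φ k)).ψ) atTop := hF (fun k => Ψ (φ k)) c hc hT
    _ ≤ m := liminf_le_of_frequently_le' (Frequently.of_forall fun k => hΨm (φ k))

/-- `Λ_L` is a Borel set. -/
theorem measurableSet_box' (L : ℝ) : MeasurableSet (box L) := by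
  have : box L = ⋂ k : Fin 3, (fun x : Space => x k) ⁻¹' Set.Ioo 0 L := by
    ext x; simp [box]
  rw [this]
  exact MeasurableSet.iInter fun k => measurableSet_Ioo.preimage (by fun_prop)

/-- The constant mode `φ₀ = L^{-3/2} 1_{Λ_L}` is measurable. -/
theorem measurable_constMode (L : ℝ) :
    Measurable ((box L).indicator fun _ : Space => ((Real.sqrt (L ^ 3))⁻¹ : ℂ)) :=
  measurable_const.indicator (measurableSet_box' L)

/-- The constant mode is square integrable: `∫ |φ₀|² < ⊤`. -/
theorem lintegral_constMode_ne_top (L : ℝ) :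
    ∫⁻ x : Space, (‖(box L).indicator (fun _ : Space => ((Real.sqrt (L ^ 3))⁻¹ : ℂ)) x‖₊ : ℝ≥0∞) ^ 2 ≠ ⊤ := by
  have hle : ∀ x : Space,
      (‖(box L).indicator (fun _ : Space => ((Real.sqrt (L ^ 3))⁻¹ : ℂ)) x‖₊ : ℝ≥0∞) ^ 2 ≤
        (box L).indicator (fun _ => ((‖((Real.sqrt (L ^ 3))⁻¹ : ℂ)‖₊ : ℝ≥0∞) ^ 2)) x := by
    intro x
    by_cases hx : x ∈ box L
    · simp only [Set.indicator_of_mem hx, le_refl]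
    · simp [Set.indicator_of_notMem hx]
  refine ne_top_of_le_ne_top ?_ (lintegral_mono hle)
  rw [lintegral_indicator_const (measurableSet_box' L)]
  exact ENNReal.mul_ne_top (ENNReal.pow_ne_top ENNReal.coe_ne_top)
    (ne_top_of_le_ne_top ENNReal.ofReal_ne_top (volume_box_le L))

/-- **The transfer at fixed `N = n+1`, `L`** under nondegeneracy of the ground state: compactness of
near-minimisers modulo phase (`hK`), lower semicontinuity of `m₂` (`hM`) and of occupations (`hO`) along trial
states, and the deletion bound `N ≤ n₀ · m₂` for the nonnegative ground state (`hD`) turn "for every `δ > 0`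
some `δ`-near-minimiser has `m₂ ≤ C`" into "for some `δ > 0` every `δ`-near-minimiser has
`⟨φ₀, γ_Ψ φ₀⟩ ≥ N/(2C)`": `m₂(Ψ₀) ≤ C` and `N ≤ n₀(Ψ₀) m₂(Ψ₀)`; were the conclusion false, `k⁻¹`-near-minimisers
with `n₀ < N/(2C)` would give `n₀(Ψ₀) ≤ N/(2C)` and `N ≤ N/2`. -/
theorem transfer_fixedN (v : ℝ → ℝ≥0∞) (n : ℕ) (L : ℝ)
    (hUq : HasUniqueGroundState v (n + 1) L)
    (hK : ∀ (Ψ : ℕ → TrialState (n + 1) L) (δ : ℕ → ℝ≥0∞),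
      (∀ k, energy v (Ψ k) ≤ groundStateEnergy v (n + 1) L + δ k) → Tendsto δ atTop (𝓝 0) →
        ∃ φ : ℕ → ℕ, StrictMono φ ∧ ∃ c : ℂ, ‖c‖ = 1 ∧
          TendstoL2 (fun k => Ψ (φ k)) (fun X => c * (groundState v (n + 1) L X : ℂ)))
    (hM : ∀ (Θ : ℕ → TrialState (n + 1) L) (Φ : Config (n + 1) → ℂ) (c : ℂ),
      Measurable Φ → ‖c‖ = 1 → TendstoL2 Θ (fun X => c * Φ X) →
        meanSelfDensity n L Φ ≤ liminf (fun k => meanSelfDensity n L (Θ k).ψ) atTop)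
    (hO : ∀ (φ : Space → ℂ) (Θ : ℕ → TrialState (n + 1) L) (Φ : Config (n + 1) → ℂ) (c : ℂ),
      Measurable φ → ∫⁻ x, (‖φ x‖₊ : ℝ≥0∞) ^ 2 ≠ ⊤ → Measurable Φ → ‖c‖ = 1 →
      TendstoL2 Θ (fun X => c * Φ X) →
        occupation (n + 1) φ Φ ≤ liminf (fun k => occupation (n + 1) φ (Θ k).ψ) atTop)
    (hD : ∀ Ψ : Config (n + 1) → ℂ, Measurable Ψ → (∀ X, X ∉ boxN (n + 1) L → Ψ X = 0) →
      (∀ X, (Ψ X).im = 0 ∧ 0 ≤ (Ψ X).re) → ∫⁻ X, (‖Ψ X‖₊ : ℝ≥0∞) ^ 2 = 1 →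
        ((n + 1 : ℕ) : ℝ≥0∞) ≤
          occupation (n + 1) ((box L).indicator fun _ => ((Real.sqrt (L ^ 3))⁻¹ : ℂ)) Ψ *
            meanSelfDensity n L Ψ) :
    ∀ C : ℝ, 0 < C →
      (∀ δ : ℝ≥0∞, 0 < δ → ∃ Ψ : TrialState (n + 1) L,
        energy v Ψ ≤ groundStateEnergy v (n + 1) L + δ ∧ meanSelfDensity n L Ψ.ψ ≤ ENNReal.ofReal C) →
      ∃ δ : ℝ≥0∞, 0 < δ ∧ ∀ Ψ : TrialState (n + 1) L,
        energy v Ψ ≤ groundStateEnergy v (n + 1) L + δ →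
          ENNReal.ofReal ((n + 1) / (2 * C)) ≤
            occupation (n + 1) ((box L).indicator fun _ => ((Real.sqrt (L ^ 3))⁻¹ : ℂ)) Ψ.ψ := by
  intro C hC hhyp
  -- THE nonnegative ground state `Ψ₀` (honest branch of `groundState`, by `hUq.1`)
  have hGS : IsGroundState v L (fun X => (groundState v (n + 1) L X : ℂ)) :=
    hUq.isGroundState_groundState
  have hmeas : Measurable (fun X => (groundState v (n + 1) L X : ℂ)) := hGS.measurable
  -- Step 1 (K + M): `m₂(Ψ₀) ≤ C`
  have h1 : meanSelfDensity n L (fun X => (groundState v (n + 1) L X : ℂ)) ≤ ENNReal.ofReal C :=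
    le_of_nearMinimisers (fun X => (groundState v (n + 1) L X : ℂ)) (meanSelfDensity n L) _ hK
      (fun Θ c hc hT => hM Θ _ c hmeas hc hT) hhyp
  -- Step 2 (D): `N ≤ n₀(Ψ₀) · m₂(Ψ₀)`
  have h2 := hD (fun X => (groundState v (n + 1) L X : ℂ)) hmeas hGS.eq_zero
    (fun X => ⟨Complex.ofReal_im _,
      le_of_le_of_eq (groundState_nonneg v (n + 1) L X) (Complex.ofReal_re _).symm⟩) hGS.norm_eq
  -- Step 3 (K + O): if the conclusion failed, `n₀(Ψ₀) ≤ N/(2C)`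
  by_contra hcon
  push Not at hcon
  have h3 : occupation (n + 1) ((box L).indicator fun _ => ((Real.sqrt (L ^ 3))⁻¹ : ℂ))
      (fun X => (groundState v (n + 1) L X : ℂ)) ≤ ENNReal.ofReal ((n + 1) / (2 * C)) :=
    le_of_nearMinimisers (fun X => (groundState v (n + 1) L X : ℂ))
      (occupation (n + 1) ((box L).indicator fun _ => ((Real.sqrt (L ^ 3))⁻¹ : ℂ))) _ hK
      (fun Θ c hc hT => hO _ Θ _ c (measurable_constMode L) (lintegral_constMode_ne_top L) hmeas hc hT)
      (fun δ hδ => by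
        obtain ⟨Ψ, hΨE, hΨlt⟩ := hcon δ hδ
        exact ⟨Ψ, hΨE, hΨlt.le⟩)
  -- Step 4: `N ≤ (N/(2C)) · C = N/2`, absurd for `N = n + 1 ≥ 1`
  have h4 : ((n + 1 : ℕ) : ℝ≥0∞) ≤ ENNReal.ofReal ((n + 1) / (2 * C)) * ENNReal.ofReal C :=
    h2.trans (mul_le_mul' h3 h1)
  have hq : (0 : ℝ) ≤ (n + 1) / (2 * C) := by positivity
  rw [← ENNReal.ofReal_mul hq, ← ENNReal.ofReal_natCast] at h4
  have h5 := (ENNReal.ofReal_le_ofReal_iff (by positivity : (0 : ℝ) ≤ (n + 1) / (2 * C) * C)).1 h4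
  have hCC : ((n : ℝ) + 1) / (2 * C) * C = ((n : ℝ) + 1) / 2 := by
    rw [div_mul_eq_mul_div, mul_div_mul_right _ _ hC.ne']
  rw [hCC] at h5
  push_cast at h5
  have hn0 : (0 : ℝ) ≤ n := n.cast_nonneg
  linarith

end Glue

/-! ### The assembly: stubs ⟹ the crux, by name -/

open Literature.MathematicalPhysics.QuantumManyBody.BoseGas in
/-- **The composition** `E → U → K → M → O → D → DeletionReachesGroundState` (the route decl, BY NAME;
hypotheses by their audit names `Goal.stub_*`, verbatim the stub statements). Fix `v`; take `ρ₁` from E and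
`ρ₂` from U and `ρ₀ = min ρ₁ ρ₂`; for `0 < ρ < ρ₀` intersect the two eventualities in `n`; at such `n`, with
`L = sideLength ρ (n+1) > 0`, `HasUniqueGroundState v (n+1) L := ⟨E, U⟩` and `transfer_fixedN` (fed K at
`(v, n+1, L)`, M and O at `(n, L)`, D at `(n, L)`) is the crux's inner statement — the inlined `m₂` term of the
route decl is `meanSelfDensity n L Ψ.ψ` by `rfl`. -/
theorem DeletionReachesGroundState_of :
    Goal.stub_groundState_exists → Goal.stub_groundStateUnique → Goal.stub_nearMinimisers_tendstoL2 →
      Goal.stub_meanSelfDensity_lsc → Goal.stub_occupation_lsc → Goal.stub_deletionBound →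
      Summit.AtomisticToContinuum.BoseEinsteinCondensation.Theses.BECDeletionChiSquare.DeletionReachesGroundState := by
  intro hE hU hK hM hO hD v hv
  obtain ⟨ρ₁, hρ₁, hev₁⟩ := hE v hv
  obtain ⟨ρ₂, hρ₂, hev₂⟩ := hU v hv
  refine ⟨min ρ₁ ρ₂, lt_min hρ₁ hρ₂, fun ρ hρ hρlt => ?_⟩
  filter_upwards [hev₁ ρ hρ (lt_of_lt_of_le hρlt (min_le_left _ _)),
    hev₂ ρ hρ (lt_of_lt_of_le hρlt (min_le_right _ _))] with n hex huniq
  have hLpos : 0 < sideLength ρ (n + 1) := by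
    unfold sideLength
    exact Real.rpow_pos_of_pos (div_pos (Nat.cast_pos.2 n.succ_pos) hρ) _
  have hUq : HasUniqueGroundState v (n + 1) (sideLength ρ (n + 1)) := ⟨hex, huniq⟩
  exact transfer_fixedN v n (sideLength ρ (n + 1)) hUq
    (hK v (n + 1) (sideLength ρ (n + 1)) hv hUq) (hM n (sideLength ρ (n + 1)))
    (hO n (sideLength ρ (n + 1))) (hD n (sideLength ρ (n + 1)) hLpos)

/-- The skeleton as a (sorried-through-the-stubs) proof of the crux (D-0027 §3.3 shape): `_of` applied to the
six `stub_*` theorems — also the guard that their verbatim types are the `Goal.stub_*` statements. -/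
theorem DeletionReachesGroundState_proof :
    Summit.AtomisticToContinuum.BoseEinsteinCondensation.Theses.BECDeletionChiSquare.DeletionReachesGroundState :=
  DeletionReachesGroundState_of stub_groundState_exists stub_groundStateUnique
    stub_nearMinimisers_tendstoL2 stub_meanSelfDensity_lsc stub_occupation_lsc stub_deletionBound

end Summit.AtomisticToContinuum.BoseEinsteinCondensation.Cruxes.DeletionReachesGroundState.Birth
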